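import Literature.Analysis.Asymptotics.MonomialAmplitudeMoments
import Mathlib.Topology.ContinuousMap.StoneWeierstrass
import HarnessLib

/-!
# Power-log asymptotics of a monomial phase with a continuous amplitude

The amplitude version of the elementary (monomial) case of the asymptotic theory of Laplace
integrals (Lin 2017, Prop. 2.1: the amplitude is a smooth `φ`, the statement concerns the
leading pole; AGV II §7.2, Lemma 7.5 (1) / Thm. 7.3: leading coefficient for `φ ≥ 0`, `φ(0) > 0`):
with `vol_w = ∏_j x_j^{w_j-1} dx_j` on the cube, `A_t = {∏ x_j^{κ_j} ≤ t}` and the scale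
`N(t) = t^λ (log 1/t)^{θ-1}`, `λ = rlct κ w`, `θ = rlctMult κ w`, for every CONTINUOUS amplitude `ψ`
the normalised sublevel integrals `∫_{A_t} ψ dvol_w / N(t)` converge as `t → 0⁺`
(`tendsto_amplitude`); the limit is monotone in `ψ` and positive as soon as `ψ` is bounded below
by a positive constant on the cube (`tendsto_amplitude_pos_of_le`).  (Positivity under the
weaker hypothesis `ψ ≥ 0`, `ψ(0) > 0` and the Laplace-integral form are in
`MonomialAmplitudeLaplace.lean`.)

Proof: polynomial amplitudes are linear combinations of monomials, whose normalised moments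
converge (`MonomialAmplitudeMoments.lean`); polynomials are uniformly dense in the continuous
functions on the compact cube (Stone–Weierstrass), and the normalised masses stay bounded, so the
normalised integrals of a continuous amplitude form a Cauchy filter.

Everything is PROVED; no definitions, no named facts.

## References

* S. Lin, arXiv:1003.5338, Prop. 2.1. [Lin2017]
* V. I. Arnold, S. M. Gusein-Zade, A. N. Varchenko, *Singularities of Differentiable Maps II*
  (2012), Part II §7.2, Lemma 7.5, Thm. 7.3. [ArnoldGuseinzadeVarchenko2012]
-/

noncomputable section

open MeasureTheory Filter Set Topology

open scoped ENNReal

namespace Literature.Analysis.Asymptotics.MonomialPhase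

variable {d : ℕ} {κ : Fin d → ℕ} {w : Fin d → ℝ}

/-! ## Continuous amplitudes are integrable for the cube weight -/

/-- The cube `(0,1]^d` lies in the compact cube `[0,1]^d`. [folklore] -/
theorem cube_subset_Icc : (Set.pi univ fun _ : Fin d => Ioc (0 : ℝ) 1) ⊆ Icc 0 1 := fun _ hx =>
  ⟨fun j => (hx j (mem_univ j)).1.le, fun j => (hx j (mem_univ j)).2⟩

/-- A continuous amplitude is `vol_w`-integrable. [folklore] -/
theorem integrable_of_continuous (hw : ∀ j, 0 < w j) {g : (Fin d → ℝ) → ℝ} (hg : Continuous g) :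
    Integrable g (Measure.pi fun j => powMeasure (w j)) := by
  haveI := isFiniteMeasure_pi_powMeasure hw
  obtain ⟨B, hB⟩ := (isCompact_Icc (a := (0 : Fin d → ℝ)) (b := 1)).exists_bound_of_continuousOn
    hg.continuousOn
  refine Integrable.mono' (integrable_const B) hg.aestronglyMeasurable ?_
  exact (ae_mem_cube hw).mono fun x hx => hB x (cube_subset_Icc hx)

/-! ## Polynomial amplitudes -/

/-- The coordinate functions as continuous maps. [folklore] -/
theorem continuous_coord (j : Fin d) : Continuous fun x : Fin d → ℝ => x j := continuous_apply j

/-- The algebra generated by the coordinate functions separates points. [folklore] -/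
theorem separatesPoints_adjoin_coord :
    (Algebra.adjoin ℝ (Set.range fun j : Fin d =>
      (⟨fun x => x j, continuous_coord j⟩ : C(Fin d → ℝ, ℝ)))).SeparatesPoints := by
  intro x y hxy
  obtain ⟨j, hj⟩ := Function.ne_iff.1 hxy
  refine ⟨_, ⟨⟨fun x => x j, continuous_coord j⟩, Algebra.subset_adjoin ⟨j, rfl⟩, rfl⟩, ?_⟩
  exact hj

/-- Every element of the algebra generated by the coordinate functions has convergent normalised
sublevel integrals (it is a linear combination of monomials). [folklore] -/
theorem tendsto_of_mem_adjoin (hκ : κ ≠ 0) (hw : ∀ j, 0 < w j) {p : C(Fin d → ℝ, ℝ)}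
    (hp : p ∈ Algebra.adjoin ℝ (Set.range fun j : Fin d =>
      (⟨fun x => x j, continuous_coord j⟩ : C(Fin d → ℝ, ℝ)))) :
    ∃ c : ℝ, Tendsto (fun t : ℝ =>
      (∫ x in {x : Fin d → ℝ | ∏ j, x j ^ κ j ≤ t}, p x ∂(Measure.pi fun j => powMeasure (w j))) /
        (t ^ rlct κ w * Real.log t⁻¹ ^ (rlctMult κ w - 1))) (𝓝[>] 0) (𝓝 c) := by
  rw [← Subalgebra.mem_toSubmodule, Algebra.adjoin_eq_span] at hp
  refine Submodule.span_induction (p := fun p _ => ∃ c : ℝ, Tendsto (fun t : ℝ =>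
      (∫ x in {x : Fin d → ℝ | ∏ j, x j ^ κ j ≤ t}, p x ∂(Measure.pi fun j => powMeasure (w j))) /
        (t ^ rlct κ w * Real.log t⁻¹ ^ (rlctMult κ w - 1))) (𝓝[>] 0) (𝓝 c))
    ?_ ?_ ?_ ?_ hp
  · -- monomials
    intro m hm
    have hmon : ∃ n : Fin d → ℕ, ∀ x, m x = ∏ j, x j ^ n j := by
      refine Submonoid.closure_induction (motive := fun m _ => ∃ n : Fin d → ℕ, ∀ x,
        m x = ∏ j, x j ^ n j) ?_ ⟨0, fun x => by simp⟩ ?_ hm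
      · rintro _ ⟨j, rfl⟩
        refine ⟨Pi.single j 1, fun x => ?_⟩
        simp only [ContinuousMap.coe_mk, Pi.single_apply, pow_ite, pow_one, pow_zero]
        rw [Finset.prod_ite_eq']
        simp
      · rintro m₁ m₂ - - ⟨n₁, h₁⟩ ⟨n₂, h₂⟩
        refine ⟨n₁ + n₂, fun x => ?_⟩
        rw [ContinuousMap.mul_apply, h₁, h₂, ← Finset.prod_mul_distrib]
        exact Finset.prod_congr rfl fun j _ => by rw [Pi.add_apply, pow_add]
    obtain ⟨n, hn⟩ := hmon
    obtain ⟨c, -, hc⟩ := tendsto_moment hκ hw n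
    refine ⟨c, ?_⟩
    simp_rw [hn]
    exact hc
  · exact ⟨0, by simp⟩
  · rintro p q - - ⟨a, ha⟩ ⟨b, hb⟩
    refine ⟨a + b, ?_⟩
    have h := ha.add hb
    refine h.congr' (Eventually.of_forall fun t => ?_)
    rw [← add_div]
    congr 1
    rw [← integral_add (integrable_of_continuous hw p.continuous).integrableOn
      (integrable_of_continuous hw q.continuous).integrableOn]
    rfl
  · rintro a p - ⟨b, hb⟩
    refine ⟨a * b, ?_⟩
    refine (hb.const_mul a).congr' (Eventually.of_forall fun t => ?_)
    rw [← mul_div_assoc]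
    congr 1
    rw [← integral_const_mul]
    rfl

/-- **Polynomial approximation with convergent normalised integrals**: every continuous amplitude
is uniformly approximated on `[0,1]^d` by amplitudes whose normalised sublevel integrals
converge (Stone–Weierstrass). [folklore] -/
theorem exists_near_tendsto (hκ : κ ≠ 0) (hw : ∀ j, 0 < w j) (ψ : (Fin d → ℝ) → ℝ)
    (hψ : Continuous ψ) {ε : ℝ} (hε : 0 < ε) :
    ∃ g : (Fin d → ℝ) → ℝ, Continuous g ∧ (∀ x ∈ Icc (0 : Fin d → ℝ) 1, |g x - ψ x| < ε) ∧
      ∃ c : ℝ, Tendsto (fun t : ℝ =>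
        (∫ x in {x : Fin d → ℝ | ∏ j, x j ^ κ j ≤ t}, g x ∂(Measure.pi fun j => powMeasure (w j))) /
          (t ^ rlct κ w * Real.log t⁻¹ ^ (rlctMult κ w - 1))) (𝓝[>] 0) (𝓝 c) := by
  obtain ⟨g, hgA, hg⟩ :=
    ContinuousMap.exists_mem_subalgebra_near_continuous_of_isCompact_of_separatesPoints
      separatesPoints_adjoin_coord ⟨ψ, hψ⟩ isCompact_Icc hε
  exact ⟨g, g.continuous, fun x hx => by simpa [Real.norm_eq_abs] using hg x hx,
    tendsto_of_mem_adjoin hκ hw hgA⟩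

/-! ## Continuous amplitudes -/

/-- **Asymptotics of the sublevel integrals of a monomial with a continuous amplitude**
(Lin 2017, Prop. 2.1; AGV II §7.2): for `κ ≠ 0`, weights `w_j > 0` and a continuous `ψ`, the
normalised integrals `∫_{x^κ ≤ t} ψ dvol_w / (t^λ (log 1/t)^{θ-1})` converge as `t → 0⁺`
(`λ = rlct κ w`, `θ = rlctMult κ w`). [cite: Lin2017, Prop. 2.1]
[cite: ArnoldGuseinzadeVarchenko2012, Part II §7.2 Thm. 7.1] -/
theorem tendsto_amplitude (hκ : κ ≠ 0) (hw : ∀ j, 0 < w j) (ψ : (Fin d → ℝ) → ℝ)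
    (hψ : Continuous ψ) :
    ∃ c : ℝ, Tendsto (fun t : ℝ =>
      (∫ x in {x : Fin d → ℝ | ∏ j, x j ^ κ j ≤ t}, ψ x ∂(Measure.pi fun j => powMeasure (w j))) /
        (t ^ rlct κ w * Real.log t⁻¹ ^ (rlctMult κ w - 1))) (𝓝[>] 0) (𝓝 c) := by
  set μ : Measure (Fin d → ℝ) := Measure.pi fun j => powMeasure (w j) with hμ
  set N : ℝ → ℝ := fun t => t ^ rlct κ w * Real.log t⁻¹ ^ (rlctMult κ w - 1) with hN
  set F : ℝ → ℝ := fun t => (∫ x in {x : Fin d → ℝ | ∏ j, x j ^ κ j ≤ t}, ψ x ∂μ) / N t with hF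
  haveI : IsFiniteMeasure μ := isFiniteMeasure_pi_powMeasure hw
  obtain ⟨M, hM, hMev⟩ := eventually_sublevelVolume_le hκ hw
  have hlog : Tendsto (fun t : ℝ => Real.log t⁻¹) (𝓝[>] 0) atTop :=
    Real.tendsto_log_atTop.comp tendsto_inv_nhdsGT_zero
  have hNpos : ∀ᶠ t : ℝ in 𝓝[>] 0, 0 < N t := by
    filter_upwards [self_mem_nhdsWithin, hlog.eventually (eventually_gt_atTop 0)] with t
      (ht : 0 < t) hL
    exact mul_pos (Real.rpow_pos_of_pos ht _) (pow_pos hL _)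
  -- it suffices to show that `F` is Cauchy along `t → 0⁺`
  suffices hc : Cauchy (map F (𝓝[>] (0 : ℝ))) by
    obtain ⟨c, hc⟩ := CompleteSpace.complete hc
    exact ⟨c, hc⟩
  rw [Metric.cauchy_iff]
  refine ⟨map_neBot, fun ε hε => ?_⟩
  -- a polynomial approximant
  obtain ⟨g, hg, hclose, cg, hcg⟩ := exists_near_tendsto hκ hw ψ hψ
    (ε := ε / (4 * M)) (by positivity)
  have hG : ∀ᶠ t : ℝ in 𝓝[>] 0,
      dist ((∫ x in {x : Fin d → ℝ | ∏ j, x j ^ κ j ≤ t}, g x ∂μ) / N t) cg < ε / 4 :=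
    Metric.tendsto_nhds.1 hcg _ (by positivity)
  have hdiff : ∀ᶠ t : ℝ in 𝓝[>] 0,
      dist (F t) ((∫ x in {x : Fin d → ℝ | ∏ j, x j ^ κ j ≤ t}, g x ∂μ) / N t) ≤ ε / 4 := by
    filter_upwards [hMev, hNpos] with t hm hNt
    rw [Real.dist_eq, hF]
    dsimp only
    rw [← sub_div, ← integral_sub (integrable_of_continuous hw hψ).integrableOn
      (integrable_of_continuous hw hg).integrableOn, abs_div, abs_of_pos hNt, div_le_iff₀ hNt]
    have hmass : (μ {x : Fin d → ℝ | ∏ j, x j ^ κ j ≤ t}).toReal ≤ M * N t := by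
      rwa [div_le_iff₀ hNt] at hm
    calc |∫ x in {x : Fin d → ℝ | ∏ j, x j ^ κ j ≤ t}, (ψ x - g x) ∂μ|
          ≤ ε / (4 * M) * μ.real {x : Fin d → ℝ | ∏ j, x j ^ κ j ≤ t} := by
            rw [← Real.norm_eq_abs]
            refine norm_setIntegral_le_of_norm_le_const_ae' (measure_lt_top _ _) ?_
            refine (ae_mem_cube hw).mono fun x hx _ => ?_
            rw [Real.norm_eq_abs, abs_sub_comm]
            exact (hclose x (cube_subset_Icc hx)).le
      _ ≤ ε / (4 * M) * (M * N t) := by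
            rw [measureReal_def]
            gcongr
      _ = ε / 4 * N t := by
            field_simp
  obtain ⟨S, hS, hSprop⟩ := (hG.and hdiff).exists_mem
  refine ⟨F '' S, image_mem_map hS, ?_⟩
  rintro _ ⟨t, ht, rfl⟩ _ ⟨t', ht', rfl⟩
  obtain ⟨h1, h2⟩ := hSprop t ht
  obtain ⟨h1', h2'⟩ := hSprop t' ht'
  have h3 := dist_triangle4 (F t) ((∫ x in {x : Fin d → ℝ | ∏ j, x j ^ κ j ≤ t}, g x ∂μ) / N t)
    cg (F t')
  have h4 := dist_triangle cg ((∫ x in {x : Fin d → ℝ | ∏ j, x j ^ κ j ≤ t'}, g x ∂μ) / N t')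
    (F t')
  rw [dist_comm cg ((∫ x in {x : Fin d → ℝ | ∏ j, x j ^ κ j ≤ t'}, g x ∂μ) / N t'),
    dist_comm ((∫ x in {x : Fin d → ℝ | ∏ j, x j ^ κ j ≤ t'}, g x ∂μ) / N t') (F t')] at h4
  linarith

/-- **Monotonicity of the limit in the amplitude**: if `ψ₁ ≤ ψ₂` on `[0,1]^d` then the limits
compare. [folklore] -/
theorem amplitude_limit_mono (hw : ∀ j, 0 < w j) {ψ₁ ψ₂ : (Fin d → ℝ) → ℝ}
    (hψ₁ : Continuous ψ₁) (hψ₂ : Continuous ψ₂) (hle : ∀ x ∈ Icc (0 : Fin d → ℝ) 1, ψ₁ x ≤ ψ₂ x)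
    {c₁ c₂ : ℝ}
    (h₁ : Tendsto (fun t : ℝ =>
      (∫ x in {x : Fin d → ℝ | ∏ j, x j ^ κ j ≤ t}, ψ₁ x ∂(Measure.pi fun j => powMeasure (w j))) /
        (t ^ rlct κ w * Real.log t⁻¹ ^ (rlctMult κ w - 1))) (𝓝[>] 0) (𝓝 c₁))
    (h₂ : Tendsto (fun t : ℝ =>
      (∫ x in {x : Fin d → ℝ | ∏ j, x j ^ κ j ≤ t}, ψ₂ x ∂(Measure.pi fun j => powMeasure (w j))) /
        (t ^ rlct κ w * Real.log t⁻¹ ^ (rlctMult κ w - 1))) (𝓝[>] 0) (𝓝 c₂)) :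
    c₁ ≤ c₂ := by
  have hlog : Tendsto (fun t : ℝ => Real.log t⁻¹) (𝓝[>] 0) atTop :=
    Real.tendsto_log_atTop.comp tendsto_inv_nhdsGT_zero
  refine le_of_tendsto_of_tendsto h₁ h₂ ?_
  filter_upwards [self_mem_nhdsWithin, hlog.eventually (eventually_gt_atTop 0)] with t
    (ht : 0 < t) hL
  have hNt : 0 < t ^ rlct κ w * Real.log t⁻¹ ^ (rlctMult κ w - 1) :=
    mul_pos (Real.rpow_pos_of_pos ht _) (pow_pos hL _)
  refine div_le_div_of_nonneg_right ?_ hNt.le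
  refine integral_mono_ae (integrable_of_continuous hw hψ₁).integrableOn
    (integrable_of_continuous hw hψ₂).integrableOn ?_
  exact ae_restrict_of_ae ((ae_mem_cube hw).mono fun x hx => hle x (cube_subset_Icc hx))

/-- **Positivity of the limit for amplitudes bounded below on the cube**: if `m ≤ ψ` on `[0,1]^d`
with `m > 0` then the limit is at least `m C > 0`, `C` the constant of `tendsto_sublevelVolume`.
[cite: ArnoldGuseinzadeVarchenko2012, Part II §7.2 Lemma 7.5] -/
theorem tendsto_amplitude_pos_of_le (hκ : κ ≠ 0) (hw : ∀ j, 0 < w j) (ψ : (Fin d → ℝ) → ℝ)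
    (hψ : Continuous ψ) {m : ℝ} (hm : 0 < m) (hle : ∀ x ∈ Icc (0 : Fin d → ℝ) 1, m ≤ ψ x) :
    ∃ c : ℝ, 0 < c ∧ Tendsto (fun t : ℝ =>
      (∫ x in {x : Fin d → ℝ | ∏ j, x j ^ κ j ≤ t}, ψ x ∂(Measure.pi fun j => powMeasure (w j))) /
        (t ^ rlct κ w * Real.log t⁻¹ ^ (rlctMult κ w - 1))) (𝓝[>] 0) (𝓝 c) := by
  obtain ⟨c, hc⟩ := tendsto_amplitude hκ hw ψ hψ
  obtain ⟨C, hC, hV⟩ := tendsto_sublevelVolume κ hw hκ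
  refine ⟨c, lt_of_lt_of_le (mul_pos hm hC) ?_, hc⟩
  have hconst : Tendsto (fun t : ℝ =>
      (∫ x in {x : Fin d → ℝ | ∏ j, x j ^ κ j ≤ t}, (fun _ => m) x
        ∂(Measure.pi fun j => powMeasure (w j))) /
        (t ^ rlct κ w * Real.log t⁻¹ ^ (rlctMult κ w - 1))) (𝓝[>] 0) (𝓝 (m * C)) := by
    refine (hV.const_mul m).congr' (Eventually.of_forall fun t => ?_)
    dsimp only
    rw [setIntegral_const, smul_eq_mul, measureReal_def]
    ring
  exact amplitude_limit_mono hw continuous_const hψ hle hconst hc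

end Literature.Analysis.Asymptotics.MonomialPhase

end
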